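import Summits.AtomisticToContinuum.HydrodynamicLimit.Theorems.AntiMazurCoboundariesCorrectorPressureDecayKiferCanonicalLocalLimitTranslation
import Summits.AtomisticToContinuum.HydrodynamicLimit.Theorems.MourreKoopmanChargesStressStrongMixingGibbsTranslation
import Literature.MathematicalPhysics.KineticTheory.HardSphereGibbsGNZSandwich

/-!
# Cells of the blown-up torus cube: the cell seam lemma and the translation covariance of the free measure
# (line `FirstLemma`, crux stmt-AtomisticToContinuum-14135)

Helper file of the registered stubs `c9_windowRestrict_cell_blowUp_eq_translate` (W2-5a) and
`c9_gibbsSpecMeasure_empty_translate` (W2-5b) of the Gibbs route of the uniform entropy bound (lead seat c9),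
namespace `Summit.AtomisticToContinuum.HydrodynamicLimit.Theorems.KiferCompactification`.

The blow-up `blowUp ε x₀ z = {(ε⁻¹ reprSym ((z i).1 - x₀), (z i).2)}` of a torus configuration lives in the cube
`C = (-S/2, S/2]³`, `S = ε⁻¹` (`Torus.reprSym ∈ (-1/2, 1/2]³`), tiled by the `m³` half-open cells
`c9Cell S m j = c9CellCorner S m j + c9Cell S m 0`, `c9CellCorner S m j = (jᵢ S/m)ᵢ`. In the Gibbs route the finite-`N`
cell inequality is summed over the cells; each cell term becomes a cell-`0` term at a SHIFTED BASE POINT by the seam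
lemma of this file, and the free reference measure on the cell `j` becomes the translate of the free reference measure
on the cell `0` by the covariance lemma, so that the Haar average over `x₀` turns the sum over cells into `m³` times the
average (the tiling identity).

* `c9Cell`, `c9CellCorner` — the cells and their corners; `mem_c9Cell_iff_sub_corner_mem` (`cell j = corner j + cell 0`),
  `mul_apply_mem_Ioc_of_mem_c9Cell` (cells of the cube of side `ε⁻¹` lie in the cube: `ε y ∈ (-1/2, 1/2]³`).
* `blowUpPoint_sub_proj_eq` — the seam lemma ACROSS THE CUT of the torus, point form: if `reprSym (q.1 - x) + s` stays
  in `(-1/2, 1/2]³` coordinatewise then `blowUpPoint ε (x - proj s) q = blowUpPoint ε x q + (ε⁻¹ s, 0)` — no smallness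
  of `s` (the tree's `Torus.reprSym_add_proj`; compare the ball version `blowUpPoint_add_eq` of
  `…KiferCanonicalLocalLimitTranslation.lean`, which needs `2ε(R + ‖a‖) < 1`).
* `c9_windowRestrict_cell_blowUp_eq_translate` — **the configuration seam lemma for cells**: for EVERY cell `j`
  (including the cells touching the boundary of the cube, thanks to the common half-open `Ioc` convention of the cells
  and of `Torus.reprSym`), the window `cell j` of `blowUp ε x₀ z` is the translate by `(corner j, 0)` of the window
  `cell 0` of the blow-up around the shifted base point `x₀ + proj (ε corner j)`: a blown-up particle `y = ε⁻¹ r` in the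
  cell `j` has `y - corner j ∈ cell 0 ⊆ C`, so `r - ε corner j ∈ (-1/2, 1/2]³` is the representative of the particle
  seen from the shifted base point, and conversely.
* `gibbsWeight_empty_image_const_add`, `c9_gibbsSpecMeasure_empty_translate` — **translation covariance of the free
  finite-volume measure**: `γ_{c+Λ}(· | ∅) = γ_Λ(· | ∅) ∘ τ_{(c,0)}⁻¹` as measures (`gibbsSpecMeasure`, diameter `1`), a
  corollary of the tree's covariance of the weights `gibbsWeight_translate`
  (`…MourreKoopmanChargesStressStrongMixingGibbsTranslation.lean`: Lebesgue measure is translation invariant, the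
  Maxwellian factor only sees velocities, the hard core only sees position differences; Georgii, *Gibbs Measures and
  Phase Transitions*, (5.8)–(5.10)) at the translation-invariant empty boundary condition, the normalisation
  `gibbsWeight … univ` being invariant as well.

References: S. Olla, S. R. S. Varadhan, H.-T. Yau, Comm. Math. Phys. 155 (1993) §3 (blow-ups around a moving base
point); H.-O. Georgii, *Gibbs Measures and Phase Transitions*, de Gruyter 1988/2011, (5.8)–(5.10).
-/

noncomputable section

open MeasureTheory Set
open scoped ENNReal NNReal

namespace Summit.AtomisticToContinuum.HydrodynamicLimit.Theorems.KiferCompactification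

open Literature.MathematicalPhysics.KineticTheory (T3 V3 blowUpPoint blowUp)
open Literature.MathematicalPhysics.KineticTheory.HardSphereDLR (gibbsSpecMeasure gibbsWeightMeasure
  gibbsWeightMeasure_apply)
open Literature.MathematicalPhysics.KineticTheory.PointProcess (windowRestrict)
open Literature.Analysis.FluidPDE (Config gibbsWeight)
open Literature.Analysis.FunctionSpaces (PointConfig)
open Literature.Analysis.FluidPDE.Torus (reprSym)
open Literature.Analysis.FunctionSpaces.Torus (proj)
open Summit.AtomisticToContinuum.HydrodynamicLimit.Theorems.MourreKoopmanChargesStressStrongMixing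
  (gibbsWeight_translate)

/-- The CELL with multi-index `j` of the cube `(-S/2, S/2]³` cut into `m³` congruent half-open boxes of side `S/m`:
`{y | ∀ i, y i ∈ (-S/2 + jᵢ S/m, -S/2 + (jᵢ+1) S/m]}` (the blown-up torus at scale `ε = S⁻¹` is the cube `(-S/2, S/2]³`,
`Torus.reprSym` takes values in `(-1/2, 1/2]³`). -/
def c9Cell (S : ℝ) (m : ℕ) (j : Fin 3 → Fin m) : Set V3 :=
  {y | ∀ i, y i ∈ Ioc (-S / 2 + ((j i : ℕ) : ℝ) * (S / m)) (-S / 2 + (((j i : ℕ) : ℝ) + 1) * (S / m))}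

/-- The lower CORNER of the cell `j` relative to the cell `0`: the vector `(jᵢ S/m)ᵢ`, so that
`c9Cell S m j = corner + c9Cell S m 0`. -/
def c9CellCorner (S : ℝ) (m : ℕ) (j : Fin 3 → Fin m) : V3 :=
  WithLp.toLp 2 fun i => ((j i : ℕ) : ℝ) * (S / m)

/-! ## Cells and corners -/

/-- `c9Cell S m j = c9CellCorner S m j + c9Cell S m 0`, pointwise: `y` lies in the cell `j` iff `y - corner j` lies in
the cell `0`. -/
theorem mem_c9Cell_iff_sub_corner_mem (S : ℝ) {m : ℕ} (hm : 0 < m) (j : Fin 3 → Fin m) (y : V3) :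
    y ∈ c9Cell S m j ↔ y - c9CellCorner S m j ∈ c9Cell S m fun _ => ⟨0, hm⟩ := by
  simp only [c9Cell, c9CellCorner, mem_setOf_eq, PiLp.sub_apply, Nat.cast_zero, zero_mul, zero_add, add_zero, one_mul,
    mem_Ioc]
  refine forall_congr' fun k => ?_
  constructor <;> rintro ⟨h1, h2⟩ <;> constructor <;> linarith [h1, h2]

/-- The cells of the cube of side `ε⁻¹` lie in the cube: `ε y ∈ (-1/2, 1/2]³` coordinatewise for `y` in a cell. -/
theorem mul_apply_mem_Ioc_of_mem_c9Cell {ε : ℝ} (hε : 0 < ε) {m : ℕ} (hm : 0 < m) {j : Fin 3 → Fin m} {y : V3}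
    (hy : y ∈ c9Cell ε⁻¹ m j) (k : Fin 3) : ε * y k ∈ Ioc (-(1 / 2 : ℝ)) (1 / 2) := by
  have hne : ε ≠ 0 := hε.ne'
  have hm0 : (0 : ℝ) < m := Nat.cast_pos.2 hm
  have hu : 0 ≤ ε⁻¹ / m := div_nonneg (inv_nonneg.2 hε.le) hm0.le
  have ha0 : (0 : ℝ) ≤ ((j k : ℕ) : ℝ) := Nat.cast_nonneg _
  have ham : ((j k : ℕ) : ℝ) + 1 ≤ m := by
    have h : (j k : ℕ) + 1 ≤ m := (j k).2
    exact_mod_cast h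
  obtain ⟨h1, h2⟩ := hy k
  have hlow : -ε⁻¹ / 2 ≤ -ε⁻¹ / 2 + ((j k : ℕ) : ℝ) * (ε⁻¹ / m) := le_add_of_nonneg_right (mul_nonneg ha0 hu)
  have hup : -ε⁻¹ / 2 + (((j k : ℕ) : ℝ) + 1) * (ε⁻¹ / m) ≤ ε⁻¹ / 2 := by
    have h : (((j k : ℕ) : ℝ) + 1) * (ε⁻¹ / m) ≤ m * (ε⁻¹ / m) := mul_le_mul_of_nonneg_right ham hu
    rw [mul_div_cancel₀ _ hm0.ne'] at h
    linarith
  have hy1 : -ε⁻¹ / 2 < y k := lt_of_le_of_lt hlow h1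
  have hy2 : y k ≤ ε⁻¹ / 2 := h2.trans hup
  constructor
  · have h := mul_lt_mul_of_pos_left hy1 hε
    rwa [show ε * (-ε⁻¹ / 2) = -(1 / 2) by field_simp] at h
  · have h := mul_le_mul_of_nonneg_left hy2 hε.le
    rwa [show ε * (ε⁻¹ / 2) = 1 / 2 by field_simp] at h

/-! ## The seam lemma for cells -/

/-- **Seam lemma across the cut of the torus, point form.** If `reprSym (q.1 - x) + s` stays in the half-open cube
`(-1/2, 1/2]³` coordinatewise, then blowing up `q` around the shifted base point `x - proj s` is translating its blow-up
around `x` by `(ε⁻¹ s, 0)` — with no smallness condition on `s`. -/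
theorem blowUpPoint_sub_proj_eq {ε : ℝ} (x : T3) (s : V3) (q : T3 × V3)
    (h : ∀ i, reprSym (q.1 - x) i + s i ∈ Ioc (-(1 / 2 : ℝ)) (1 / 2)) :
    blowUpPoint ε (x - proj s) q = blowUpPoint ε x q + (ε⁻¹ • s, 0) := by
  have h1 : q.1 - (x - proj s) = (q.1 - x) + proj s := by abel
  simp only [blowUpPoint, h1, Literature.Analysis.FluidPDE.Torus.reprSym_add_proj h, smul_add, Prod.mk_add_mk,
    add_zero]

/-- **The configuration seam lemma for cells** (W2-5a). For every cell `j` of the cube of side `ε⁻¹` cut into `m³`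
cells, every base point `x₀` and every torus configuration `z`: the window `cell j` of the blow-up `blowUp ε x₀ z` is
the translate by `(corner j, 0)` of the window `cell 0` of the blow-up around the shifted base point
`x₀ + proj (ε corner j)` (equality of configurations; valid also for the cells touching the boundary of the cube, by
the common half-open convention of `c9Cell` and `Torus.reprSym`). -/
theorem c9_windowRestrict_cell_blowUp_eq_translate {ε : ℝ} (hε : 0 < ε) {m : ℕ} (hm : 0 < m) (j : Fin 3 → Fin m)
    (x₀ : T3) {n : ℕ} (z : Config n (Fin 3) T3) :
    windowRestrict (c9Cell ε⁻¹ m j) (blowUp ε x₀ z) =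
      (windowRestrict (c9Cell ε⁻¹ m fun _ => ⟨0, hm⟩) (blowUp ε (x₀ + proj (ε • c9CellCorner ε⁻¹ m j)) z)).translate
        (c9CellCorner ε⁻¹ m j, 0) := by
  have hne : ε ≠ 0 := hε.ne'
  set c : V3 := c9CellCorner ε⁻¹ m j
  ext p
  rw [mem_windowRestrict_iff, mem_translate_iff, mem_windowRestrict_iff,
    Literature.MathematicalPhysics.KineticTheory.mem_blowUp, Literature.MathematicalPhysics.KineticTheory.mem_blowUp]
  constructor
  · rintro ⟨⟨i, hi⟩, hp⟩
    set r : V3 := reprSym ((z i).1 - x₀)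
    have hp1 : p.1 = ε⁻¹ • r := by rw [← hi]; rfl
    -- the position relative to the corner lies in the cell `0`
    have hp0 : (p - (c, 0)).1 ∈ c9Cell ε⁻¹ m fun _ => ⟨0, hm⟩ := by
      rw [Prod.fst_sub]
      exact (mem_c9Cell_iff_sub_corner_mem ε⁻¹ hm j p.1).1 hp
    refine ⟨⟨i, ?_⟩, hp0⟩
    have hcube : ∀ k, r k + (-(ε • c)) k ∈ Ioc (-(1 / 2 : ℝ)) (1 / 2) := fun k => by
      have e : r k + (-(ε • c)) k = ε * (p - (c, 0)).1 k := by
        rw [Prod.fst_sub, hp1, PiLp.neg_apply, PiLp.sub_apply, PiLp.smul_apply, PiLp.smul_apply, smul_eq_mul,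
          smul_eq_mul, mul_sub, ← mul_assoc, mul_inv_cancel₀ hne, one_mul, sub_eq_add_neg]
      rw [e]
      exact mul_apply_mem_Ioc_of_mem_c9Cell hε hm hp0 k
    have key := blowUpPoint_sub_proj_eq (ε := ε) x₀ (-(ε • c)) (z i) hcube
    rw [Literature.Analysis.FunctionSpaces.Torus.proj_neg, sub_neg_eq_add, hi, smul_neg, smul_smul,
      inv_mul_cancel₀ hne, one_smul] at key
    rw [key, sub_eq_add_neg, Prod.neg_mk, neg_zero]
  · rintro ⟨⟨i, hi⟩, hp⟩
    set r : V3 := reprSym ((z i).1 - (x₀ + proj (ε • c)))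
    have hp1 : (p - (c, 0)).1 = ε⁻¹ • r := by rw [← hi]; rfl
    -- the position lies in the cell `j`
    have hpj : p.1 ∈ c9Cell ε⁻¹ m j := by
      rw [mem_c9Cell_iff_sub_corner_mem ε⁻¹ hm j p.1]
      rwa [Prod.fst_sub] at hp
    refine ⟨⟨i, ?_⟩, hpj⟩
    have hcube : ∀ k, r k + (ε • c) k ∈ Ioc (-(1 / 2 : ℝ)) (1 / 2) := fun k => by
      have h3 : (p - (c, 0)).1 k = ε⁻¹ * r k := by rw [hp1, PiLp.smul_apply, smul_eq_mul]
      rw [Prod.fst_sub, PiLp.sub_apply] at h3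
      have e : r k + (ε • c) k = ε * p.1 k := by
        have h4 : r k = ε * (p.1 k - c k) := by rw [h3, ← mul_assoc, mul_inv_cancel₀ hne, one_mul]
        rw [h4, PiLp.smul_apply, smul_eq_mul]
        ring
      rw [e]
      exact mul_apply_mem_Ioc_of_mem_c9Cell hε hm hpj k
    have key := blowUpPoint_sub_proj_eq (ε := ε) (x₀ + proj (ε • c)) (ε • c) (z i) hcube
    rw [add_sub_cancel_right, hi, smul_smul, inv_mul_cancel₀ hne, one_smul, sub_add_cancel] at key
    exact key

/-! ## Translation covariance of the free finite-volume measure -/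

/-- Translates of the empty configuration are empty. -/
theorem pointConfig_translate_empty (v : V3 × V3) : (∅ : PointConfig (V3 × V3)).translate v = ∅ := by
  refine PointConfig.ext fun x => ?_
  change x ∈ ((∅ : PointConfig (V3 × V3)).translate v).carrier ↔ x ∈ (∅ : PointConfig (V3 × V3)).carrier
  simp

/-- The shifted window `c + Λ` pulled back by `· + c` is `Λ`. -/
theorem preimage_add_const_image_const_add (c : V3) (Λ : Set V3) : (· + c) ⁻¹' ((c + ·) '' Λ) = Λ := by
  ext y
  refine ⟨fun ⟨x, hx, hxy⟩ => ?_, fun hy => ⟨y, hy, add_comm c y⟩⟩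
  have hxy' : c + x = y + c := hxy
  have : x = y := add_left_cancel (hxy'.trans (add_comm y c))
  exact this ▸ hx

/-- Shifted windows of measurable windows are measurable. -/
theorem measurableSet_image_const_add {Λ : Set V3} (hΛ : MeasurableSet Λ) (c : V3) :
    MeasurableSet ((c + ·) '' Λ) := by
  rw [Set.image_add_left]
  exact (measurable_const_add (-c)) hΛ

/-- **Translation covariance of the free weights**: the weight of the event `A` in the window `c + Λ` with empty
boundary condition is the weight of `A - (c, 0)` in the window `Λ` (the tree's `gibbsWeight_translate` at the empty,
translation-invariant boundary condition). -/
theorem gibbsWeight_empty_image_const_add (ε z β : ℝ) (u : V3) (Λ : Set V3) (c : V3)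
    (A : Set (PointConfig (V3 × V3))) :
    gibbsWeight ε z β u ((c + ·) '' Λ) ∅ A =
      gibbsWeight ε z β u Λ ∅ (PointConfig.translate ((c, 0) : V3 × V3) ⁻¹' A) := by
  have h : gibbsWeight ε z β u ((c + ·) '' Λ) ((∅ : PointConfig (V3 × V3)).translate ((c, 0) : V3 × V3)) A =
      gibbsWeight ε z β u ((· + c) ⁻¹' ((c + ·) '' Λ)) ∅ (PointConfig.translate ((c, 0) : V3 × V3) ⁻¹' A) :=
    gibbsWeight_translate ε z β u _ ∅ A rfl
  rwa [pointConfig_translate_empty, preimage_add_const_image_const_add] at h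

/-- **Translation covariance of the free finite-volume measure** (W2-5b): the finite-volume Gibbs measure with empty
boundary condition in the shifted window `c + Λ` is the image of the one in `Λ` under the translation `τ_{(c,0)}` of
configurations (the weight measures correspond under `τ_{(c,0)}` by `gibbsWeight_empty_image_const_add`, and the
normalisations `gibbsWeight … univ` agree). -/
theorem c9_gibbsSpecMeasure_empty_translate (z β : ℝ) (u : V3) {Λ : Set V3} (hΛ : MeasurableSet Λ) (c : V3) :
    gibbsSpecMeasure 1 z β u ((c + ·) '' Λ) ∅ =
      (gibbsSpecMeasure 1 z β u Λ ∅).map (PointConfig.translate (c, (0 : V3))) := by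
  have hΛ' : MeasurableSet ((c + ·) '' Λ) := measurableSet_image_const_add hΛ c
  have hτ := PointConfig.measurable_translate (E := V3 × V3) ((c, 0) : V3 × V3)
  have hW : gibbsWeightMeasure 1 z β u ((c + ·) '' Λ) ∅ =
      (gibbsWeightMeasure 1 z β u Λ ∅).map (PointConfig.translate ((c, 0) : V3 × V3)) := by
    refine Measure.ext fun A hA => ?_
    rw [Measure.map_apply hτ hA, gibbsWeightMeasure_apply 1 z β u hΛ' ∅ hA,
      gibbsWeightMeasure_apply 1 z β u hΛ ∅ (hτ hA), gibbsWeight_empty_image_const_add]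
  have huniv : gibbsWeight 1 z β u ((c + ·) '' Λ) ∅ univ = gibbsWeight 1 z β u Λ ∅ univ := by
    rw [gibbsWeight_empty_image_const_add, Set.preimage_univ]
  simp only [gibbsSpecMeasure, Measure.map_smul, hW, huniv]

end Summit.AtomisticToContinuum.HydrodynamicLimit.Theorems.KiferCompactification

end
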